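import Literature.MathematicalPhysics.QuantumFieldTheory.Balaban1983to89.B8Ineq159CurvedCubeMemberReads
import Literature.MathematicalPhysics.QuantumFieldTheory.Balaban1983to89.B8LayerAxialGauge
import Literature.MathematicalPhysics.QuantumFieldTheory.Balaban1983to89.B8Ineq159CurvedCubeMemberInAk

/-!
# `Balaban1983to89.B8Ineq159CurvedCubeMemberInAkVerbatim` — [Balaban1985RegularSpaces] (1.59) p. 86 «for `U₀ ∈ 𝔄_k({Ω_j}, α₀)`» ON THE CUBE MEMBER, PER
# MEMBER, AT THE MEMBER'S OWN DOMAIN SEQUENCE `{□_j}` VERBATIM: smallness asked ONLY of the plaquettes touching `□₀` (p. 77's «p ∈ Ω₀», the level-`0`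
# clause of (1.7) with `Ω₀ = □₀`) — no collar ∕ neighbourhood side condition — truncation `1` (`U1`-valued backgrounds) and all truncations (averaging-closed
# `G`, unitary C⋆ backgrounds)

statement-level skeleton of published theorems with citation tags; proofs where landed; nothing here is a claim about the
Yang–Mills mass gap

`[Balaban1985RegularSpaces]` ("B8", CMP **99** (1985) 75–102) p. 77 (`𝔄_k({Ω_j}, α₀)`, (1.7), the touching convention), (1.11) p. 78, Lemma 1 p. 79, (1.38) p. 82,
(1.55) p. 86, (1.59) p. 86, (1.62) p. 87, (1.131) p. 99; [B7] = `[Balaban1985Averaging]` (CMP **98** (1985) 17–51) p. 24, (42)–(43) pp. 23–24, Prop. 2 (52)–(54)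
p. 26; [4] = `[Balaban1985BackgroundPropagators]` Thm 3.3 p. 399, (3.19) p. 393, (3.23)–(3.25) p. 394.

CITATION HEADER (lean-in-tree rule).  Cell `pub-ymgap` (YM Track A, HUMAN RULING D-0062 ∕ D-0149), DAG node N05 = [B8], width seat `pub-ymgap-dag-n05-w3`
(g3), CLAIM-1 file (V).  WHY.  File (H) of this seat (`B8Ineq159CurvedCubeMemberInAk`, g2) reached print's currency `B8Ineq132.InAk` only for domain
sequences whose `Ω₀` contains the collar box `□₀ + (L+4)`; at the member's OWN sequence `{□_j} = cubeFam false …` (the currency of the N06→N05 binders, e.g.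
`B9SupplySockB9P3ZdGammaInAk.CurvAtInAk`'s `InAk L m i.η α₀ i.Ω U₀`) that side condition fails, and g2's ■ line left this case OPEN.  THIS FILE closes it:
file (R) shows every hypothesis of the member's (1.59) reads `U₀` only on the sides of the plaquettes touching `□₀` and that the derivative targets follow from
the `|φ|`-target; file (L) gives the layer axial gauge and the transfer schema `of_touching_plaquettes`; composed with files (E)∕(E′) (the uniform ball along
gauge transformations) they give (1.59) per member for EVERY background whose plaquettes touching `□₀` are `α₀(□)`-small — in particular for every
`U₀ ∈ 𝔄_{k′}({□_j}, α₀)`, `k′` arbitrary.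

THE MATHEMATICS (kernel-checked).  §1 `sqLo_le_sqHi₀` (the top cube is a genuine box), private `exists_ne_dir` (`d ≥ 2`); §2 ★★ `curved159_perCube_of_ballGauge` — the
CORE: for a subgroup `H ≤ U1` and a truncation `m ≤ k`, a uniform-ball-along-gauge-transformations statement of the (1.59) triple at `H`-valued backgrounds
(files (E)∕(E′)) implies the same triple (constant `(4d+3)L^{3m}B′`) for every `H`-valued `U₀` whose plaquettes touching `□₀` are `α₀`-small: the schema
`B8LayerAxialGauge.of_touching_plaquettes` run on the `|φ|`-target property (locality leg = file (R): `isLandau138_congr_touch`, `Jcur_congr_touch`,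
`linCovIter_congr_cubeLamBP`), then `derivTargets_of_phiTarget` for the two derivative targets at `U₀` itself; §3 ★★★ `exists_curved159_perCube_touching`
(`m = 1`, `U1`-valued, from (E)) and ★★★ `exists_curved159_perCube_inAk_verbatim` (its `InAk L k′ η α₀ (cubeFam false L a M ρ k) U₀` form — (H)'s theorem WITHOUT
the hypothesis `Ω₀ ⊇ □₀ + (L+4)`); §4 ★★★ `exists_curved159_perCube_touching_tower` ∕ `exists_curved159_perCube_inAk_verbatim_tower` (all `1 ≤ m ≤ k`,
`2 ≤ L`, averaging-closed `G`, from (E′)) and ★ `exists_curved159_perCube_inAk_verbatim_unitary` (unitary backgrounds of a C⋆-algebra, [B7] (42)–(43)).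

HONEST SCOPE ∕ A6.  PER MEMBER: `α₀(□, m)`, `B″(□, m)` depend on the member and `𝔸` (finite-dimensional factorisation upstream), NOT explicit, NOT print's uniform
`α₀`, `B₀(d, L)`; only the level-`0` plaquette clause of (1.7) is used (neither (1.9) nor the level weights `α₀L^{−2j}`, which is MORE than print needs here, not
less); the derivative targets carry member-dependent powers of `L` (file (R) §5).  This IS the hypothesis shape of the sockets' `InAk … i.Ω` at the member's own
domain sequence, but NOT an inhabitant of `SockB9P3` ∕ `SockH59` ∕ `CurvAtInAk` as typed (those ask UNIFORM constants = [4] Thm 3.3, the N06 object layer).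
Non-vacuity: `U₀ = 1 ∈ 𝔄_k` for every `α₀ > 0`, `φ = 0`.  Count-neutral; N05 NOT discharged; no count claim; one finite `𝕋⁴` programme at fixed `ε`, Bałaban as
printed; the YM mass gap (Clay) is NOT proved by any of this — R4 closes the conditional finite-`𝕋⁴` rung `BalabanLadder.UV` only; nothing continuum ∕ ℝ⁴ ∕
OS.  No `sorry`, no `def`, no `instance`, no `notation`.  Unit `pub-ymgap-dag-n05-w3` (g3), 2026-08-28.
-/

noncomputable section

namespace Literature.MathematicalPhysics.QuantumFieldTheory.Balaban1983to89.B8Ineq159CurvedCubeMemberInAkVerbatim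

open B7Prop1Explicit B7Prop2Explicit B7Prop1Local
open B7Prop4GeneralLevels (linCovIter)
open B8Ineq132 (covDerivFwd BondTouches PlaqTouches plaqF CondAt InAk)
open B8Eq140Level (SideTouches sideTouches_of_bondTouches sideTouches_mono)
open B8Eq146AExpansion (iEta)
open B8Eq155JBound (Jcur)
open B8Eq138LandauZd (IsLandau138 covLap)
open B8Eq131Cubes (cube sqLo sqHi cube_anti gs one_le_gs)
open B8Eq131CubesAdmissible (cubeFam cubeFam_false_zero cubeFam_false_of_le)
open B8CubeMemberZd (cubeLamS)
open B8Ineq159FlatCubeMemberPrinted (cubeLamBP)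
open B8Ineq159FlatCubeMemberKernel (mem_cube_zero_iff)
open B8Ineq159CurvedCubeMemberReads (isLandau138_congr_touch Jcur_congr_touch linCovIter_congr_cubeLamBP derivTargets_of_phiTarget)
open B8LayerAxialGauge (of_touching_plaquettes)
open B8Ineq159GaugeCovariance (exists_curved159_perCube_truncOne_gauge)
open B8Ineq159GaugeCovarianceTower (exists_curved159_perCube_gauge)

-- `Site` alone would resolve to the torus sites of `Setup.lean`; re-export the `ℤ^d` sites of `B7Prop1Explicit`.
export B7Prop1Explicit (Site)

variable {d : ℕ}

/-! ## §1 Geometry of the member's top cube -/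

section Geometry

/-- The member's top cube `□₀ = [sqLo₀, sqHi₀]` is a genuine box (`ρ ≥ 1`): `sqHi₀ − sqLo₀ = LᵏM − 1 + 2ρ·gs ≥ 1`.
[cite: Balaban1985RegularSpaces, p.98 («a distance between boundaries of these cubes is equal to R₁M₁Lʲη»), (1.131) p.99] -/
theorem sqLo_le_sqHi₀ (L : ℕ) (a : Site d) (M : ℕ) {ρ : ℕ} (hρ : 1 ≤ ρ) (k : ℕ) : ∀ i, sqLo L a ρ k 0 i ≤ sqHi L a M ρ k 0 i := by
  intro i
  have hgs : 1 ≤ gs L (k - 0) := one_le_gs L _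
  have h1 : (1 : ℤ) ≤ (ρ : ℤ) * (gs L (k - 0) : ℤ) := by
    have : (1 : ℤ) ≤ ρ := by exact_mod_cast hρ
    have : (1 : ℤ) ≤ gs L (k - 0) := by exact_mod_cast hgs
    nlinarith
  have hM : (0 : ℤ) ≤ (L : ℤ) ^ (k - 0) * M := by positivity
  simp only [sqLo, sqHi, B8Eq131Cubes.bLo, B8Eq131Cubes.bHi, Nat.cast_mul]
  nlinarith

/-- In `d ≥ 2` dimensions every direction has another one. [folklore] -/
private theorem exists_ne_dir (hd2 : 2 ≤ d) (κ : Fin d) : ∃ κ' : Fin d, κ' ≠ κ := by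
  haveI : Nontrivial (Fin d) := Fin.nontrivial_iff_two_le.mpr hd2
  exact exists_ne κ

end Geometry

/-! ## §2 The core: uniform ball along gauge transformations ⟹ every background with small plaquettes touching `□₀` -/

section Core

variable {𝔸 : Type*} [NormedRing 𝔸] [NormOneClass 𝔸] [NormedAlgebra ℂ 𝔸] [CompleteSpace 𝔸]

set_option maxHeartbeats 400000 in
-- one long transfer proof (schema instantiation + three locality read-backs + the target bookkeeping); twice the default budget, no heavy automation
/-- ★★ **THE CORE TRANSFER.**  Let `H ≤ U1` be a subgroup, `□ = (L, a, M, ρ, k)` a cube member with `1 ≤ L ≤ ρ`, `m ≤ k`, `d ≥ 2`, `η > 0`, and suppose the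
(1.59) triple at truncation `m` with constant `B′` holds at EVERY background `V^u`, `u` a `U1`-valued gauge transformation and `V` an `H`-valued field with
`‖V(b) − 1‖ ≤ δ₀` on all bonds (files (E)∕(E′)).  Then there is `α₀ > 0` such that the triple, with constant `(4d+3)L^{3m}B′`, holds at every `H`-valued `U₀`
whose plaquettes TOUCHING `□₀` are `α₀`-small.  PROOF: `B8LayerAxialGauge.of_touching_plaquettes` for the property «every `φ` in the curved Landau gauge of `U`
with the support clause and data bounds `N` has `(Lʲη)|φ| ≤ B′N` on the side-touching bonds» — its locality leg is file (R) (`isLandau138_congr_touch`,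
`Jcur_congr_touch`, `linCovIter_congr_cubeLamBP`: the hypotheses read `U` only on the sides of the plaquettes touching `□₀`; the target is `U`-free) — then
`derivTargets_of_phiTarget` at `U₀` for `D^η_{U₀}φ`, `Δ^η_{U₀}φ`.
[cite: Balaban1985RegularSpaces, (1.59) p.86, (1.62) p.87, p.77, (1.7) p.77, (1.11) p.78, Lemma 1 p.79, (1.38) p.82; Balaban1985Averaging, p.24; Balaban1985BackgroundPropagators, (3.19) p.393, (3.23)–(3.25) p.394] -/
theorem curved159_perCube_of_ballGauge {H : Subgroup 𝔸ˣ} (hH : H ≤ U1 𝔸) (hd2 : 2 ≤ d) {L : ℕ} (hL : 1 ≤ L) {η : ℝ} (hη : 0 < η)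
    (a : Site d) (M : ℕ) {ρ : ℕ} (hρ : L ≤ ρ) {k m : ℕ} (hmk : m ≤ k) {δ₀ B' : ℝ} (hδ₀ : 0 < δ₀) (hB' : 0 < B')
    (HBG : ∀ (u : Site d → 𝔸ˣ), (∀ x, u x ∈ U1 𝔸) →
      ∀ (V : Site d → Fin d → 𝔸ˣ), (∀ x κ, V x κ ∈ H) → (∀ x κ, ‖((V x κ : 𝔸ˣ) : 𝔸) - 1‖ ≤ δ₀) →
      ∀ φ : Site d → Fin d → 𝔸,
        IsLandau138 L m η (cubeFam false L a M ρ k 0) (cubeLamS L a M ρ k m) (gaugeAct u V) φ →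
        (∀ (y : Site d) (τ : Fin d), (∀ j, j ≤ m → ¬ SideTouches (cubeFam false L a M ρ k j) y τ) → φ y τ = 0) →
        ∀ N : ℝ, 0 ≤ N →
          (∀ j, j ≤ m → ∀ (y : Site d) (τ : Fin d), BondTouches (cubeFam false L a M ρ k j) y τ →
              ((L : ℝ) ^ j * η) ^ 3 * ‖Jcur η (gaugeAct u V) φ τ y‖ ≤ N) →
          (∀ j, j ≤ m → ∀ c ∈ cubeLamBP L a M ρ k m j, ‖linCovIter L (gaugeAct u V) (iEta η φ) j c.1 c.2‖ ≤ N) →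
          (∀ (y : Site d) (τ : Fin d), ¬ BondTouches (cubeFam false L a M ρ k 0) y τ → η * ‖φ y τ‖ ≤ N) →
          ∀ j, j ≤ m → ∀ (y : Site d) (τ : Fin d), SideTouches (cubeFam false L a M ρ k j) y τ →
            ((L : ℝ) ^ j * η) * ‖φ y τ‖ ≤ B' * N ∧
            (∀ ν : Fin d, ((L : ℝ) ^ j * η) ^ 2 * ‖covDerivFwd η (gaugeAct u V) ν (fun z => φ z τ) y‖ ≤ B' * N) ∧
            ((L : ℝ) ^ j * η) ^ 3 * ‖covLap η (gaugeAct u V) (fun z => φ z τ) y‖ ≤ B' * N) :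
    ∃ α₀ : ℝ, 0 < α₀ ∧ ∀ (U₀ : Site d → Fin d → 𝔸ˣ), (∀ x κ, U₀ x κ ∈ H) →
      (∀ (z : Site d) (κ μ : Fin d), κ ≠ μ → PlaqTouches (cubeFam false L a M ρ k 0) z κ μ → ‖plaqF U₀ κ μ z - 1‖ ≤ α₀) →
      ∀ φ : Site d → Fin d → 𝔸,
        IsLandau138 L m η (cubeFam false L a M ρ k 0) (cubeLamS L a M ρ k m) U₀ φ →
        (∀ (y : Site d) (τ : Fin d), (∀ j, j ≤ m → ¬ SideTouches (cubeFam false L a M ρ k j) y τ) → φ y τ = 0) →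
        ∀ N : ℝ, 0 ≤ N →
          (∀ j, j ≤ m → ∀ (y : Site d) (τ : Fin d), BondTouches (cubeFam false L a M ρ k j) y τ →
              ((L : ℝ) ^ j * η) ^ 3 * ‖Jcur η U₀ φ τ y‖ ≤ N) →
          (∀ j, j ≤ m → ∀ c ∈ cubeLamBP L a M ρ k m j, ‖linCovIter L U₀ (iEta η φ) j c.1 c.2‖ ≤ N) →
          (∀ (y : Site d) (τ : Fin d), ¬ BondTouches (cubeFam false L a M ρ k 0) y τ → η * ‖φ y τ‖ ≤ N) →
          ∀ j, j ≤ m → ∀ (y : Site d) (τ : Fin d), SideTouches (cubeFam false L a M ρ k j) y τ →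
            ((L : ℝ) ^ j * η) * ‖φ y τ‖ ≤ (4 * d + 3) * (L : ℝ) ^ (3 * m) * B' * N ∧
            (∀ ν : Fin d, ((L : ℝ) ^ j * η) ^ 2 * ‖covDerivFwd η U₀ ν (fun z => φ z τ) y‖ ≤ (4 * d + 3) * (L : ℝ) ^ (3 * m) * B' * N) ∧
            ((L : ℝ) ^ j * η) ^ 3 * ‖covLap η U₀ (fun z => φ z τ) y‖ ≤ (4 * d + 3) * (L : ℝ) ^ (3 * m) * B' * N := by
  -- the box `□₀ = [lo, hi]` and its identification with `Ω₀ = cubeFam … 0 = cube … 0`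
  obtain ⟨lo, hlo⟩ : ∃ lo : Site d, lo = sqLo L a ρ k 0 := ⟨_, rfl⟩
  obtain ⟨hi, hhi⟩ : ∃ hi : Site d, hi = sqHi L a M ρ k 0 := ⟨_, rfl⟩
  have hlohi : ∀ i, lo i ≤ hi i := by rw [hlo, hhi]; exact sqLo_le_sqHi₀ L a M (hL.trans hρ) k
  have hΩ0 : cubeFam false L a M ρ k 0 = {y | InBox lo hi y} := by
    rw [cubeFam_false_zero, hlo, hhi]; rfl
  have hcube0 : cube L a M ρ k 0 = {y | InBox lo hi y} := by rw [hlo, hhi]; rfl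
  have hcubej : ∀ j', j' ≤ m → cubeFam false L a M ρ k j' ⊆ cube L a M ρ k 0 := fun j' hj' => by
    rw [cubeFam_false_of_le L a M ρ (hj'.trans hmk)]; exact cube_anti (Nat.zero_le j') (hj'.trans hmk)
  -- agreement on the sides of the plaquettes touching `□₀` ⇒ the three agreement currencies of file (R)
  have hbond_of_sides : ∀ {U U' : Site d → Fin d → 𝔸ˣ},
      (∀ (y : Site d) (τ : Fin d), SideTouches {z | InBox lo hi z} y τ → U y τ = U' y τ) →
      ∀ (z : Site d) (κ : Fin d), BondTouches (cube L a M ρ k 0) z κ → U z κ = U' z κ := by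
    intro U U' hag z κ hbt
    obtain ⟨κ', hκ'⟩ := exists_ne_dir hd2 κ
    rw [hcube0] at hbt
    exact hag z κ (sideTouches_of_bondTouches hκ' hbt)
  have hinside_of_sides : ∀ {U U' : Site d → Fin d → 𝔸ˣ},
      (∀ (y : Site d) (τ : Fin d), SideTouches {z | InBox lo hi z} y τ → U y τ = U' y τ) →
      ∀ (z : Site d) (κ : Fin d), z ∈ cube L a M ρ k 0 → z + e κ ∈ cube L a M ρ k 0 → U z κ = U' z κ :=
    fun hag z κ hz _ => hbond_of_sides hag z κ (Or.inl hz)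
  -- THE SCHEMA on the `|φ|`-target property
  obtain ⟨α₀, hα₀, hP⟩ := of_touching_plaquettes hH hlohi
    (P := fun U => ∀ φ : Site d → Fin d → 𝔸,
      IsLandau138 L m η (cubeFam false L a M ρ k 0) (cubeLamS L a M ρ k m) U φ →
      (∀ (y : Site d) (τ : Fin d), (∀ j, j ≤ m → ¬ SideTouches (cubeFam false L a M ρ k j) y τ) → φ y τ = 0) →
      ∀ N : ℝ, 0 ≤ N →
        (∀ j, j ≤ m → ∀ (y : Site d) (τ : Fin d), BondTouches (cubeFam false L a M ρ k j) y τ →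
            ((L : ℝ) ^ j * η) ^ 3 * ‖Jcur η U φ τ y‖ ≤ N) →
        (∀ j, j ≤ m → ∀ c ∈ cubeLamBP L a M ρ k m j, ‖linCovIter L U (iEta η φ) j c.1 c.2‖ ≤ N) →
        (∀ (y : Site d) (τ : Fin d), ¬ BondTouches (cubeFam false L a M ρ k 0) y τ → η * ‖φ y τ‖ ≤ N) →
        ∀ j, j ≤ m → ∀ (y : Site d) (τ : Fin d), SideTouches (cubeFam false L a M ρ k j) y τ →
          ((L : ℝ) ^ j * η) * ‖φ y τ‖ ≤ B' * N)
    ⟨δ₀, hδ₀, fun u hu V hV hVδ φ hLan hs N hN h1 h2 h3 j hj y τ hst =>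
      (HBG u hu V hV hVδ φ hLan hs N hN h1 h2 h3 j hj y τ hst).1⟩
    (by
      intro U U' _ _ hag hPU φ hLan' hs N hN h1' h2' h3' j hj y τ hst
      have hagB := hbond_of_sides hag
      -- the hypotheses at `U'` read back at `U`
      have hLan : IsLandau138 L m η (cubeFam false L a M ρ k 0) (cubeLamS L a M ρ k m) U φ :=
        isLandau138_congr_touch hL a M ρ hmk (fun z κ hbt => (hagB z κ hbt).symm) hLan'
      have h1 : ∀ j, j ≤ m → ∀ (y : Site d) (τ : Fin d), BondTouches (cubeFam false L a M ρ k j) y τ →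
          ((L : ℝ) ^ j * η) ^ 3 * ‖Jcur η U φ τ y‖ ≤ N := by
        intro j' hj' y' τ' hbt
        have hbt0 : BondTouches {z | InBox lo hi z} y' τ' := by
          rw [← hcube0]; exact hbt.imp (fun h => hcubej j' hj' h) (fun h => hcubej j' hj' h)
        rw [Jcur_congr_touch (η := η) φ hbt0 hag]
        exact h1' j' hj' y' τ' hbt
      have h2 : ∀ j, j ≤ m → ∀ c ∈ cubeLamBP L a M ρ k m j, ‖linCovIter L U (iEta η φ) j c.1 c.2‖ ≤ N := by
        intro j' hj' c hc
        rw [linCovIter_congr_cubeLamBP hL a M hρ hmk (iEta η φ) (hinside_of_sides hag) hc]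
        exact h2' j' hj' c hc
      exact hPU φ hLan hs N hN h1 h2 h3' j hj y τ hst)
  -- the constants
  have hL1 : (1 : ℝ) ≤ L := by exact_mod_cast hL
  have hL3 : (1 : ℝ) ≤ (L : ℝ) ^ (3 * m) := one_le_pow₀ hL1
  have hL23 : (L : ℝ) ^ (2 * m) ≤ (L : ℝ) ^ (3 * m) := pow_le_pow_right₀ hL1 (by omega)
  have hd1 : (1 : ℝ) ≤ 4 * d + 3 := by
    have : (0 : ℝ) ≤ d := by positivity
    linarith
  refine ⟨α₀, hα₀, ?_⟩
  intro U₀ hU hP₀ φ hLan hs N hN h1 h2 h3 j hj y τ hst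
  have hU1 : ∀ x κ, U₀ x κ ∈ U1 𝔸 := fun x κ => hH (hU x κ)
  -- the `|φ|`-target at `U₀` itself, on every side-touching bond of every `□_j`, `j ≤ m`
  have hφ := hP U₀ hU (fun z κ μ hκμ hpt => hP₀ z κ μ hκμ (by rw [hΩ0]; exact hpt)) φ hLan hs N hN h1 h2 h3
  have hC : 0 ≤ B' * N := mul_nonneg hB'.le hN
  obtain ⟨t2, t3⟩ := derivTargets_of_phiTarget hL hη (cubeFam false L a M ρ k) hU1 hs hC hφ hj y τ
  have hBN : B' * N ≤ (4 * d + 3) * (L : ℝ) ^ (3 * m) * B' * N := by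
    have : B' * N = 1 * 1 * (B' * N) := by ring
    rw [this, show (4 * (d : ℝ) + 3) * (L : ℝ) ^ (3 * m) * B' * N = (4 * d + 3) * (L : ℝ) ^ (3 * m) * (B' * N) by ring]
    exact mul_le_mul (mul_le_mul hd1 hL3 zero_le_one (by positivity)) le_rfl hC (by positivity)
  refine ⟨(hφ j hj y τ hst).trans hBN, fun ν => (t2 ν).trans ?_, t3.trans ?_⟩
  · calc 2 * (L : ℝ) ^ (2 * m) * (B' * N) ≤ (4 * d + 3) * (L : ℝ) ^ (3 * m) * (B' * N) :=
          mul_le_mul_of_nonneg_right (mul_le_mul (by linarith) hL23 (by positivity) (by positivity)) hC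
      _ = (4 * d + 3) * (L : ℝ) ^ (3 * m) * B' * N := by ring
  · calc 4 * (d : ℝ) * (L : ℝ) ^ (3 * m) * (B' * N) ≤ (4 * d + 3) * (L : ℝ) ^ (3 * m) * (B' * N) :=
          mul_le_mul_of_nonneg_right (mul_le_mul_of_nonneg_right (by linarith) (by positivity)) hC
      _ = (4 * d + 3) * (L : ℝ) ^ (3 * m) * B' * N := by ring

end Core

/-! ## §3 Truncation `1`, `U1`-valued backgrounds: the member's own `𝔄_k({□_j}, α₀)` verbatim -/

section TruncOne

variable {𝔸 : Type*} [NormedRing 𝔸] [NormOneClass 𝔸] [NormedAlgebra ℂ 𝔸] [CompleteSpace 𝔸]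

/-- ★★★ **(1.59) ON THE CUBE MEMBER, PER MEMBER, TRUNCATION `1`, FOR EVERY BACKGROUND WHOSE PLAQUETTES TOUCHING `□₀` ARE SMALL.**  For `d ≥ 2`, `1 ≤ L ≤ ρ`,
`η > 0`, `k ≥ 1` and `𝔸` finite-dimensional there are `α₀(□) > 0`, `B″(□) > 0` such that: for every `U1`-valued `U₀` with `‖U₀(∂p) − 1‖ ≤ α₀` for the plaquettes
`p` with a corner in `□₀` (p. 77's «p ∈ □₀» — NOTHING asked elsewhere), every `φ` in the curved Landau gauge (1.38) of `U₀` at truncation `1` supported on the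
side-touching bonds of `□₀ ∕ □₁`, and every `N ≥ 0` bounding (i) `(Lʲη)³|J_{U₀}φ|` on the bonds of `□_j`, (ii) `|Lʲη·Q_j(U₀)(iηφ)|` on print's class, (iii) `η|φ|` on
the outer layer: `(Lʲη)|φ|, (Lʲη)²|D^η_{U₀,ν}φ_τ|, (Lʲη)³|Δ^η_{U₀}φ_τ| ≤ B″N` on the sides of `□_j`, `j ≤ 1`.  PROOF: §2 on file (E)
(`exists_curved159_perCube_truncOne_gauge`) with `H := U1`. [cite: Balaban1985RegularSpaces, (1.59) p.86, (1.62) p.87, p.77, (1.7) p.77, Lemma 1 p.79, (1.38) p.82, (1.131) p.99; Balaban1985Averaging, p.24; Balaban1985BackgroundPropagators, Thm 3.3 p.399] -/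
theorem exists_curved159_perCube_touching [FiniteDimensional ℂ 𝔸] (hd2 : 2 ≤ d) {L : ℕ} (hL : 1 ≤ L) {η : ℝ} (hη : 0 < η)
    (a : Site d) (M : ℕ) {ρ : ℕ} (hρ : L ≤ ρ) {k : ℕ} (hk : 1 ≤ k) :
    ∃ α₀ B'' : ℝ, 0 < α₀ ∧ 0 < B'' ∧ ∀ (U₀ : Site d → Fin d → 𝔸ˣ), (∀ x κ, U₀ x κ ∈ U1 𝔸) →
      (∀ (z : Site d) (κ μ : Fin d), κ ≠ μ → PlaqTouches (cubeFam false L a M ρ k 0) z κ μ → ‖plaqF U₀ κ μ z - 1‖ ≤ α₀) →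
      ∀ φ : Site d → Fin d → 𝔸,
        IsLandau138 L 1 η (cubeFam false L a M ρ k 0) (cubeLamS L a M ρ k 1) U₀ φ →
        (∀ (y : Site d) (τ : Fin d), (∀ j, j ≤ 1 → ¬ SideTouches (cubeFam false L a M ρ k j) y τ) → φ y τ = 0) →
        ∀ N : ℝ, 0 ≤ N →
          (∀ j, j ≤ 1 → ∀ (y : Site d) (τ : Fin d), BondTouches (cubeFam false L a M ρ k j) y τ →
              ((L : ℝ) ^ j * η) ^ 3 * ‖Jcur η U₀ φ τ y‖ ≤ N) →
          (∀ j, j ≤ 1 → ∀ c ∈ cubeLamBP L a M ρ k 1 j, ‖linCovIter L U₀ (iEta η φ) j c.1 c.2‖ ≤ N) →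
          (∀ (y : Site d) (τ : Fin d), ¬ BondTouches (cubeFam false L a M ρ k 0) y τ → η * ‖φ y τ‖ ≤ N) →
          ∀ j, j ≤ 1 → ∀ (y : Site d) (τ : Fin d), SideTouches (cubeFam false L a M ρ k j) y τ →
            ((L : ℝ) ^ j * η) * ‖φ y τ‖ ≤ B'' * N ∧
            (∀ ν : Fin d, ((L : ℝ) ^ j * η) ^ 2 * ‖covDerivFwd η U₀ ν (fun z => φ z τ) y‖ ≤ B'' * N) ∧
            ((L : ℝ) ^ j * η) ^ 3 * ‖covLap η U₀ (fun z => φ z τ) y‖ ≤ B'' * N := by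
  obtain ⟨δ₀, B', hδ₀, hB', H⟩ := exists_curved159_perCube_truncOne_gauge (𝔸 := 𝔸) hd2 hL hη a M ρ hk
  obtain ⟨α₀, hα₀, hα⟩ := curved159_perCube_of_ballGauge (H := U1 𝔸) le_rfl hd2 hL hη a M hρ hk hδ₀ hB' H
  exact ⟨α₀, (4 * d + 3) * (L : ℝ) ^ (3 * 1) * B', hα₀, by positivity, hα⟩

/-- ★★★ **(1.59) «FOR `U₀ ∈ 𝔄_k({□_j}, α₀)`» ON THE CUBE MEMBER, PER MEMBER, AT THE MEMBER'S OWN DOMAIN SEQUENCE, TRUNCATION `1`** — file (H)'s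
`exists_curved159_perCube_inAk` WITHOUT the side condition `Ω₀ ⊇ □₀ + (L+4)`: there are `α₀(□) > 0`, `B″(□) > 0` such that for every `U1`-valued `U₀` and every
`k′`, `InAk L k′ η α₀ (cubeFam false L a M ρ k) U₀` (print's `U₀ ∈ 𝔄_{k′}({□_j}, α₀)`, (1.7)∕(1.9) with the touching convention, at `Ω_j := □_j`) implies the
(1.59) triple of `exists_curved159_perCube_touching` (only the level-`0` plaquette clause is used).
[cite: Balaban1985RegularSpaces, (1.59) p.86, (1.62) p.87, (1.7) p.77, p.77, (1.38) p.82, (1.131) p.99; Balaban1985BackgroundPropagators, Thm 3.3 p.399] -/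
theorem exists_curved159_perCube_inAk_verbatim [FiniteDimensional ℂ 𝔸] (hd2 : 2 ≤ d) {L : ℕ} (hL : 1 ≤ L) {η : ℝ} (hη : 0 < η)
    (a : Site d) (M : ℕ) {ρ : ℕ} (hρ : L ≤ ρ) {k : ℕ} (hk : 1 ≤ k) :
    ∃ α₀ B'' : ℝ, 0 < α₀ ∧ 0 < B'' ∧ ∀ (U₀ : Site d → Fin d → 𝔸ˣ), (∀ x κ, U₀ x κ ∈ U1 𝔸) →
      ∀ k' : ℕ, InAk L k' η α₀ (cubeFam false L a M ρ k) U₀ →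
      ∀ φ : Site d → Fin d → 𝔸,
        IsLandau138 L 1 η (cubeFam false L a M ρ k 0) (cubeLamS L a M ρ k 1) U₀ φ →
        (∀ (y : Site d) (τ : Fin d), (∀ j, j ≤ 1 → ¬ SideTouches (cubeFam false L a M ρ k j) y τ) → φ y τ = 0) →
        ∀ N : ℝ, 0 ≤ N →
          (∀ j, j ≤ 1 → ∀ (y : Site d) (τ : Fin d), BondTouches (cubeFam false L a M ρ k j) y τ →
              ((L : ℝ) ^ j * η) ^ 3 * ‖Jcur η U₀ φ τ y‖ ≤ N) →
          (∀ j, j ≤ 1 → ∀ c ∈ cubeLamBP L a M ρ k 1 j, ‖linCovIter L U₀ (iEta η φ) j c.1 c.2‖ ≤ N) →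
          (∀ (y : Site d) (τ : Fin d), ¬ BondTouches (cubeFam false L a M ρ k 0) y τ → η * ‖φ y τ‖ ≤ N) →
          ∀ j, j ≤ 1 → ∀ (y : Site d) (τ : Fin d), SideTouches (cubeFam false L a M ρ k j) y τ →
            ((L : ℝ) ^ j * η) * ‖φ y τ‖ ≤ B'' * N ∧
            (∀ ν : Fin d, ((L : ℝ) ^ j * η) ^ 2 * ‖covDerivFwd η U₀ ν (fun z => φ z τ) y‖ ≤ B'' * N) ∧
            ((L : ℝ) ^ j * η) ^ 3 * ‖covLap η U₀ (fun z => φ z τ) y‖ ≤ B'' * N := by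
  obtain ⟨α₀, B'', hα₀, hB'', H⟩ := exists_curved159_perCube_touching (𝔸 := 𝔸) hd2 hL hη a M hρ hk
  refine ⟨α₀, B'', hα₀, hB'', fun U₀ hU k' hAk => H U₀ hU fun z κ μ hκμ hpt => ?_⟩
  have h1 := (hAk 0 (Nat.zero_le _)).1 z κ μ hκμ hpt
  simp only [pow_zero, inv_one, one_pow, mul_one] at h1
  exact h1.le

end TruncOne

/-! ## §4 All truncations: averaging-closed groups, unitary C⋆ backgrounds -/

section Tower

variable {𝔸 : Type*} [NormedRing 𝔸] [NormOneClass 𝔸] [NormedAlgebra ℂ 𝔸] [CompleteSpace 𝔸]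

/-- ★★★ **(1.59) ON THE CUBE MEMBER, PER MEMBER, ALL TRUNCATIONS `1 ≤ m ≤ k`, FOR EVERY `G`-VALUED BACKGROUND WHOSE PLAQUETTES TOUCHING `□₀` ARE SMALL**
([B7] Prop. 2's regime: `2 ≤ L`, `G` averaging-closed; `L ≤ ρ`): §2 on file (E′) (`exists_curved159_perCube_gauge`) with `H := G`.  HONEST SCOPE in the module
docstring (per member ∕ truncation, non-explicit constants; NOT [4] Thm 3.3).
[cite: Balaban1985RegularSpaces, (1.59) p.86, (1.62) p.87, p.77, (1.7) p.77, Lemma 1 p.79, (1.38) p.82, (1.131) p.99; Balaban1985Averaging, p.24, Prop. 2 (52)–(54) p.26; Balaban1985BackgroundPropagators, Thm 3.3 p.399] -/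
theorem exists_curved159_perCube_touching_tower [FiniteDimensional ℂ 𝔸] (hd2 : 2 ≤ d) {L : ℕ} (hL2 : 2 ≤ L) {η : ℝ} (hη : 0 < η)
    {G : Subgroup 𝔸ˣ} (hG : AvgClosed d L G) (a : Site d) (M : ℕ) {ρ : ℕ} (hρ : L ≤ ρ) {k m : ℕ} (hm1 : 1 ≤ m) (hmk : m ≤ k) :
    ∃ α₀ B'' : ℝ, 0 < α₀ ∧ 0 < B'' ∧ ∀ (U₀ : Site d → Fin d → 𝔸ˣ), (∀ x κ, U₀ x κ ∈ G) →
      (∀ (z : Site d) (κ μ : Fin d), κ ≠ μ → PlaqTouches (cubeFam false L a M ρ k 0) z κ μ → ‖plaqF U₀ κ μ z - 1‖ ≤ α₀) →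
      ∀ φ : Site d → Fin d → 𝔸,
        IsLandau138 L m η (cubeFam false L a M ρ k 0) (cubeLamS L a M ρ k m) U₀ φ →
        (∀ (y : Site d) (τ : Fin d), (∀ j, j ≤ m → ¬ SideTouches (cubeFam false L a M ρ k j) y τ) → φ y τ = 0) →
        ∀ N : ℝ, 0 ≤ N →
          (∀ j, j ≤ m → ∀ (y : Site d) (τ : Fin d), BondTouches (cubeFam false L a M ρ k j) y τ →
              ((L : ℝ) ^ j * η) ^ 3 * ‖Jcur η U₀ φ τ y‖ ≤ N) →
          (∀ j, j ≤ m → ∀ c ∈ cubeLamBP L a M ρ k m j, ‖linCovIter L U₀ (iEta η φ) j c.1 c.2‖ ≤ N) →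
          (∀ (y : Site d) (τ : Fin d), ¬ BondTouches (cubeFam false L a M ρ k 0) y τ → η * ‖φ y τ‖ ≤ N) →
          ∀ j, j ≤ m → ∀ (y : Site d) (τ : Fin d), SideTouches (cubeFam false L a M ρ k j) y τ →
            ((L : ℝ) ^ j * η) * ‖φ y τ‖ ≤ B'' * N ∧
            (∀ ν : Fin d, ((L : ℝ) ^ j * η) ^ 2 * ‖covDerivFwd η U₀ ν (fun z => φ z τ) y‖ ≤ B'' * N) ∧
            ((L : ℝ) ^ j * η) ^ 3 * ‖covLap η U₀ (fun z => φ z τ) y‖ ≤ B'' * N := by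
  have hL : 1 ≤ L := le_trans (by norm_num) hL2
  obtain ⟨δ₀, B', hδ₀, hB', H⟩ := exists_curved159_perCube_gauge (𝔸 := 𝔸) hd2 hL2 hη hG a M ρ hm1 hmk
  obtain ⟨α₀, hα₀, hα⟩ := curved159_perCube_of_ballGauge (H := G) hG.le_U1 hd2 hL hη a M hρ hmk hδ₀ hB' H
  exact ⟨α₀, (4 * d + 3) * (L : ℝ) ^ (3 * m) * B', hα₀, by positivity, hα⟩

/-- ★★★ **(1.59) «FOR `U₀ ∈ 𝔄_k({□_j}, α₀)`» ON THE CUBE MEMBER, PER MEMBER, AT THE MEMBER'S OWN DOMAIN SEQUENCE, ALL TRUNCATIONS `1 ≤ m ≤ k`** (`G`-valued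
backgrounds, `G` averaging-closed, `2 ≤ L ≤ ρ`): for every `k′`, `InAk L k′ η α₀ (cubeFam false L a M ρ k) U₀` implies the (1.59) triple at truncation `m` (only the
level-`0` plaquette clause of (1.7) is used). [cite: Balaban1985RegularSpaces, (1.59) p.86, (1.62) p.87, (1.7) p.77, p.77, (1.38) p.82, (1.131) p.99; Balaban1985Averaging, Prop. 2 (52)–(54) p.26; Balaban1985BackgroundPropagators, Thm 3.3 p.399] -/
theorem exists_curved159_perCube_inAk_verbatim_tower [FiniteDimensional ℂ 𝔸] (hd2 : 2 ≤ d) {L : ℕ} (hL2 : 2 ≤ L) {η : ℝ} (hη : 0 < η)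
    {G : Subgroup 𝔸ˣ} (hG : AvgClosed d L G) (a : Site d) (M : ℕ) {ρ : ℕ} (hρ : L ≤ ρ) {k m : ℕ} (hm1 : 1 ≤ m) (hmk : m ≤ k) :
    ∃ α₀ B'' : ℝ, 0 < α₀ ∧ 0 < B'' ∧ ∀ (U₀ : Site d → Fin d → 𝔸ˣ), (∀ x κ, U₀ x κ ∈ G) →
      ∀ k' : ℕ, InAk L k' η α₀ (cubeFam false L a M ρ k) U₀ →
      ∀ φ : Site d → Fin d → 𝔸,
        IsLandau138 L m η (cubeFam false L a M ρ k 0) (cubeLamS L a M ρ k m) U₀ φ →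
        (∀ (y : Site d) (τ : Fin d), (∀ j, j ≤ m → ¬ SideTouches (cubeFam false L a M ρ k j) y τ) → φ y τ = 0) →
        ∀ N : ℝ, 0 ≤ N →
          (∀ j, j ≤ m → ∀ (y : Site d) (τ : Fin d), BondTouches (cubeFam false L a M ρ k j) y τ →
              ((L : ℝ) ^ j * η) ^ 3 * ‖Jcur η U₀ φ τ y‖ ≤ N) →
          (∀ j, j ≤ m → ∀ c ∈ cubeLamBP L a M ρ k m j, ‖linCovIter L U₀ (iEta η φ) j c.1 c.2‖ ≤ N) →
          (∀ (y : Site d) (τ : Fin d), ¬ BondTouches (cubeFam false L a M ρ k 0) y τ → η * ‖φ y τ‖ ≤ N) →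
          ∀ j, j ≤ m → ∀ (y : Site d) (τ : Fin d), SideTouches (cubeFam false L a M ρ k j) y τ →
            ((L : ℝ) ^ j * η) * ‖φ y τ‖ ≤ B'' * N ∧
            (∀ ν : Fin d, ((L : ℝ) ^ j * η) ^ 2 * ‖covDerivFwd η U₀ ν (fun z => φ z τ) y‖ ≤ B'' * N) ∧
            ((L : ℝ) ^ j * η) ^ 3 * ‖covLap η U₀ (fun z => φ z τ) y‖ ≤ B'' * N := by
  obtain ⟨α₀, B'', hα₀, hB'', H⟩ := exists_curved159_perCube_touching_tower (𝔸 := 𝔸) hd2 hL2 hη hG a M hρ hm1 hmk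
  refine ⟨α₀, B'', hα₀, hB'', fun U₀ hU k' hAk => H U₀ hU fun z κ μ hκμ hpt => ?_⟩
  have h1 := (hAk 0 (Nat.zero_le _)).1 z κ μ hκμ hpt
  simp only [pow_zero, inv_one, one_pow, mul_one] at h1
  exact h1.le

end Tower

section Unitary

variable {𝔸 : Type*} [CStarAlgebra 𝔸] [Nontrivial 𝔸]

/-- ★ **(1.59) «FOR `U₀ ∈ 𝔄_k({□_j}, α₀)`» AT THE MEMBER'S OWN DOMAIN SEQUENCE, ALL TRUNCATIONS, UNITARY BACKGROUNDS OF A C⋆-ALGEBRA** — the currency of the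
N06→N05 sockets (`unitaryUnits 𝔸`, `InAk L m i.η α₀ i.Ω U₀` with `i.Ω = cubeFam false …`): `exists_curved159_perCube_inAk_verbatim_tower` at `G := U(𝔸)`
(`B7Prop2Explicit.avgClosed_unitaryUnits`, [B7] (42)–(43)).  PER MEMBER, non-explicit constants — NOT the uniform [4] Thm 3.3 supply.
[cite: Balaban1985RegularSpaces, (1.59) p.86, (1.7) p.77, p.77; Balaban1985Averaging, (42)–(43) pp.23–24; Balaban1985BackgroundPropagators, Thm 3.3 p.399] -/
theorem exists_curved159_perCube_inAk_verbatim_unitary [FiniteDimensional ℂ 𝔸] (hd2 : 2 ≤ d) {L : ℕ} (hL2 : 2 ≤ L) {η : ℝ} (hη : 0 < η)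
    (a : Site d) (M : ℕ) {ρ : ℕ} (hρ : L ≤ ρ) {k m : ℕ} (hm1 : 1 ≤ m) (hmk : m ≤ k) :
    ∃ α₀ B'' : ℝ, 0 < α₀ ∧ 0 < B'' ∧ ∀ (U₀ : Site d → Fin d → 𝔸ˣ), (∀ x κ, U₀ x κ ∈ unitaryUnits 𝔸) →
      ∀ k' : ℕ, InAk L k' η α₀ (cubeFam false L a M ρ k) U₀ →
      ∀ φ : Site d → Fin d → 𝔸,
        IsLandau138 L m η (cubeFam false L a M ρ k 0) (cubeLamS L a M ρ k m) U₀ φ →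
        (∀ (y : Site d) (τ : Fin d), (∀ j, j ≤ m → ¬ SideTouches (cubeFam false L a M ρ k j) y τ) → φ y τ = 0) →
        ∀ N : ℝ, 0 ≤ N →
          (∀ j, j ≤ m → ∀ (y : Site d) (τ : Fin d), BondTouches (cubeFam false L a M ρ k j) y τ →
              ((L : ℝ) ^ j * η) ^ 3 * ‖Jcur η U₀ φ τ y‖ ≤ N) →
          (∀ j, j ≤ m → ∀ c ∈ cubeLamBP L a M ρ k m j, ‖linCovIter L U₀ (iEta η φ) j c.1 c.2‖ ≤ N) →
          (∀ (y : Site d) (τ : Fin d), ¬ BondTouches (cubeFam false L a M ρ k 0) y τ → η * ‖φ y τ‖ ≤ N) →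
          ∀ j, j ≤ m → ∀ (y : Site d) (τ : Fin d), SideTouches (cubeFam false L a M ρ k j) y τ →
            ((L : ℝ) ^ j * η) * ‖φ y τ‖ ≤ B'' * N ∧
            (∀ ν : Fin d, ((L : ℝ) ^ j * η) ^ 2 * ‖covDerivFwd η U₀ ν (fun z => φ z τ) y‖ ≤ B'' * N) ∧
            ((L : ℝ) ^ j * η) ^ 3 * ‖covLap η U₀ (fun z => φ z τ) y‖ ≤ B'' * N :=
  exists_curved159_perCube_inAk_verbatim_tower (𝔸 := 𝔸) hd2 hL2 hη (avgClosed_unitaryUnits d L) a M hρ hm1 hmk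

end Unitary

end Literature.MathematicalPhysics.QuantumFieldTheory.Balaban1983to89.B8Ineq159CurvedCubeMemberInAkVerbatim

end
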